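import Summits.CriticalPhenomena.PercolationContinuityZ3.Theorems.PercNearOneGluingNoHeavyLowerTailMajorityGluingQCertSym3Parts
import HarnessLib

/-!
# Two-level gluing of large symmetrised degree-3 certificates (lane prim-rate, constants-miner 1, gen 37; CANDIDATES §GEN-37 R353)

Support file for the closed crux `NoHeavyLowerTail` (stmt-CriticalPhenomena-4575), majority-gluing line.  At `m ≥ 10` a degree-3 orbit certificate has
≈ 10⁶ contributions in ≈ 30 parts; the one-level glue of `…QCertSym3Parts` (`pos_of_digests3`: ONE kernel sort of all parts' digests, ONE structural check
`checkW3S` of the concatenation — `335 rows × 4 masks × 1024 patterns` at `(10,6)`) no longer fits one kernel evaluation.  Here both steps are split: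
* **`SymCert3.wf3S`** = the entry-wise part of `checkW3S` (index ranges, `rowOK`); `checkW3S` of a concatenation follows from `wf3S` of every part, the two
  numeric base conditions and `0 < ell2DDS` of the concatenation (`checkW3S_concat_of_wf`) — so each GROUP of parts proves its members' `wf3S` separately;
* **`SymCert3.pos_of_superdigests3`**: the parts' digests are grouped, each group's key-sorted aggregated concatenation (a SUPER-DIGEST, again at most one entry
  per orbit key) is stated as data and verified in the group's file, and only the run check of the few super-digests is evaluated at the top.
No sorries.
-/

namespace Summit.CriticalPhenomena.PercolationContinuityZ3.Theorems

namespace HubOnly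
namespace QCert
namespace SymCert3

variable (c : SymCert3)

/-- The ENTRY-WISE part of the structural check: index ranges of `ell2`/`lin`/squares, `rowOK` and lift range of rows. -/
def wf3S : Bool :=
  c.ell2.all (fun e => decide (e.1 < c.NV) && decide (e.2.1 < c.NV)) &&
    c.lin.all (fun e => decide (e.1 < c.base.m) && decide (e.2.1 < c.NV) && decide (e.2.2.1 < c.NV)) &&
    c.rows.all (fun ch => ch.all fun r => c.base.rowOK r.row && decide (r.t < c.NV)) &&
    c.sqs.all (fun ch => ch.all fun s => decide (s.t < c.NV))

/-- `checkW3S` = base conditions, `0 < ell2DDS`, and the entry-wise part. -/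
theorem checkW3S_eq : c.checkW3S = (decide (0 < c.base.cD) && decide (1 ≤ c.base.h) && decide (0 < c.ell2DDS) && c.wf3S) := by
  unfold checkW3S wf3S
  simp only [Bool.and_assoc]

/-- Entry-wise well-formedness of two glued parts with the same base. -/
theorem wf3S_append (c d : SymCert3) (h : d.base = c.base) : (c.append d).wf3S = (c.wf3S && d.wf3S) := by
  cases d with
  | mk base ell2 lin rows sqs =>
    simp only at h
    subst h
    unfold append wf3S
    simp only [NV, List.all_append]
    generalize c.ell2.all _ = a1
    generalize c.lin.all _ = a2
    generalize c.rows.all _ = a3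
    generalize c.sqs.all _ = a4
    generalize ell2.all _ = b1
    generalize lin.all _ = b2
    generalize rows.all _ = b3
    generalize sqs.all _ = b4
    cases a1 <;> cases a2 <;> cases a3 <;> cases a4 <;> cases b1 <;> cases b2 <;> cases b3 <;> cases b4 <;> rfl

/-- **Entry-wise well-formedness of a concatenation from that of its parts.** -/
theorem wf3S_concat (b : Cert) : ∀ l : List SymCert3, (∀ d ∈ l, d.base = b) → (∀ d ∈ l, d.wf3S = true) → (concat b l).wf3S = true
  | [], _, _ => by unfold concat wf3S; simp
  | d :: l, hb, hw => by
    have hd : d.base = b := hb d (by simp)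
    have hl : ∀ d' ∈ l, d'.base = b := fun d' hd' => hb d' (List.mem_cons_of_mem _ hd')
    have hwl : ∀ d' ∈ l, d'.wf3S = true := fun d' hd' => hw d' (List.mem_cons_of_mem _ hd')
    rw [show concat b (d :: l) = d.append (concat b l) from rfl, wf3S_append d (concat b l) (by rw [concat_base b l hl, hd]),
      hw d (by simp), wf3S_concat b l hl hwl, Bool.true_and]

/-- **The structural check of a concatenation from its parts' entry-wise checks**, the base conditions and the `δ²`-weight of `ℓ₂`. -/
theorem checkW3S_concat_of_wf (b : Cert) (l : List SymCert3) (hb : ∀ d ∈ l, d.base = b) (hw : ∀ d ∈ l, d.wf3S = true)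
    (hcD : 0 < b.cD) (hh : 1 ≤ b.h) (hDD : 0 < (concat b l).ell2DDS) : (concat b l).checkW3S = true := by
  rw [checkW3S_eq, wf3S_concat b l hb hw, concat_base b l hb]
  simp [hcD, hh, hDD]

/-- `evalC` of a doubly nested concatenation, group by group. -/
theorem evalC_flatten_flatten (val : ℕ → ℝ) (G : List (List (List (ℕ × ℤ)))) :
    evalC val G.flatten.flatten = (G.map fun g => evalC val g.flatten).sum := by
  induction G with
  | nil => simp [evalC]
  | cons g G ih => rw [List.flatten_cons, List.flatten_append, evalC_append, ih, List.map_cons, List.sum_cons]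

/-- The values of the groups are the values of their super-digests. -/
theorem map_evalC_of_superdigests (fuel : ℕ) (val : ℕ → ℝ) {G : List (List (List (ℕ × ℤ)))} {E : List (List (ℕ × ℤ))}
    (hE : List.Forall₂ (fun g e => aggr (msort2 fuel g.flatten) = e) G E) : (G.map fun g => evalC val g.flatten) = E.map (evalC val) := by
  induction hE with
  | nil => rfl
  | cons hge _ ih => rw [List.map_cons, List.map_cons, ih, ← hge, evalC_aggr, evalC_perm val (msort2_perm fuel _)]

/-- **NONNEGATIVITY FROM SUPER-DIGESTS (two-level gluing):** the parts' digests `D` are stated and verified part by part; `D` is grouped as `G`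
(`G.flatten = D`); each group's super-digest `aggr (msort2 fuel g.flatten)` is stated as data `E` and verified in the group's file; the run check of
the key-sorted concatenation of the super-digests is evaluated at the top.  Then the glued certificate's contribution list evaluates nonnegatively at
every nonnegative key valuation. -/
theorem pos_of_superdigests3 (b : Cert) (l : List SymCert3) (hb : ∀ d ∈ l, d.base = b) (fuel : ℕ) (D : List (List (ℕ × ℤ)))
    (hD : List.Forall₂ (fun d dg => d.digest3 fuel = dg) l D) (G : List (List (List (ℕ × ℤ)))) (hG : G.flatten = D)
    (E : List (List (ℕ × ℤ))) (hE : List.Forall₂ (fun g e => aggr (msort2 fuel g.flatten) = e) G E)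
    (hruns : runsOK (msort2 fuel E.flatten) = true) (val : ℕ → ℝ) (hval : ∀ key, 0 ≤ val key) :
    0 ≤ evalC val (concat b l).contribs3S := by
  rw [evalC_concat3 b val l hb, map_evalC_of_digests3 fuel val hD, ← evalC_flatten, ← hG, evalC_flatten_flatten,
    map_evalC_of_superdigests fuel val hE, ← evalC_flatten]
  exact evalC_nonneg_of_runsOK_msort2 val hval fuel _ hruns

/-- Smoke test: the entry-wise check of the glued `(2,1)` smoke certificate (kernel evaluation). -/
theorem smokeGlue : (concat sym3Smoke.base [sym3Smoke]).wf3S = true := by decide +kernel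

end SymCert3
end QCert
end HubOnly

end Summit.CriticalPhenomena.PercolationContinuityZ3.Theorems
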